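import Mathlib
import HarnessLib
import Summits.Parity.GeneralizedHardyLittlewood.Theses.LiouvilleMAD
import Summits.Parity.GeneralizedHardyLittlewood.Theorems.FanDecorrelation.Negative.FanDecorrelationDilationAmplifier

/-!
# `FanDecorrelation` (stmt-Parity-13318) ALONE forces one-point laws for `λ` in progressions

Negation-side hardness certificate (calibration, not a refutation mechanism) for the crux
`LiouvilleMAD.FanDecorrelation` (route LiouvilleMAD, rank 3), by the line lead c9 (2026-08-17); sequel of
`FanDecorrelationDilationAmplifier` (amplifier inequality `Q·(Σ_s a_s P c n_s M)² ≤ (M + (K−1)·2Q)·((Σ_s a_s²)·QM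
+ (Σ_s |a_s|)²·C·M^{3/4+ϑ})` for DISTINCT dilations `n_s ∈ [1,2M]`).  All from the crux alone, shift by shift;
`P c n M = Σ_{m∈(M,2M]} λ(mn+c)` is the one-point sum along the class `c mod n`.
* `sum_abs_P_le_of_fanDecorrelation` / `dilationSet_sum_abs_P_le` — SQUARE-ROOT SAVING IN THE NUMBER OF MODULI:
  `Σ_{n∈S} |P c n M| ≤ C'·√#S·M` for every `M` and every `S ⊂ [1,2M]` with `#S ≤ ⌊√M⌋` (signs `a_n = sgn P`; only
  the exponent-`1` fan bound `|fan| ≤ C·M` is used, which the crux supplies with room `M^{1/4−ϑ}`).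
* `firstMoment_abs_P_le_of_fanDecorrelation` — FIXED-RESIDUE FIRST MOMENT AT LEVEL 1/2 OF THE HEIGHT:
  `Σ_{n∈(M,2M]} |Σ_{m∈(M,2M]} λ(mn+c)| ≤ C·M^{7/4}` (trivial `M²`, random `M^{3/2}`; moduli `n ≍ M ≍ √height`).
* `card_biased_dilations_le` — at most `(C'/b)²` of any `⌊√M⌋` dilations can carry a bias `|P c n M| ≥ b·M`
  (the Siegel mirrors exclude `CoherentBias`, i.e. `b²V ≥ 4` WITH a common sign; here `b²V ≤ C'²`, no signs);
  `FanDecorrelation_false_of_biasedDilations` is the `_false_of_` form (hypothesis believed false).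
READING.  For `√M` moduli `n ∈ (M,2M]` GRH bounds `P c n M` only by `(height)^{1/2+ε} ≍ M^{1+2ε}`, i.e. trivially,
while the crux forces `|P c n M|` to average `≤ C'·M^{3/4}` over any `√M` of them; for `S = [1, M^η]`, `η < 1/2`,
the average is `≤ C'·M^{1−η/2}`, a power saving where the tree's Bombieri–Vinogradov theorem for `λ`
(`LiouvilleShiftedTables.BVLiouville`) saves `(log M)^{−A}`.  One-point form of the route's Siegel caricature: an
exceptional `χ mod q` biasing `λ` by `b` along the classes `c mod n`, `q ∣ n`, gives first moment `≳ (b/q)·M²`,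
excluded for `q ≲ b·M^{1/4}/C`; heuristically (one dominant zero `β₀+iγ₀` of `ζ`, no conspiracy of the
non-principal characters) already `β₀ > (1+η/2)/(1+η)` (`= 5/6` at `η = 1/2`) violates the `M^η`-law — not
formalised; the formal content is the four displayed theorems. [folklore]
-/

noncomputable section

namespace Summit.Parity.GeneralizedHardyLittlewood.Theorems.FanDecorrelation.Negative.DilationAmplifier

open Finset
open Summit.Parity.GeneralizedHardyLittlewood.Theses.LiouvilleMAD (FanDecorrelation)
open Summit.Parity.GeneralizedHardyLittlewood.Theorems.DilatedChowla.Negative (P)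

/-! ## §1 The one-point law: square-root saving in the number of dilations -/

/-- **Square-root saving in the number of dilations (indexed form).**  Under `FanDecorrelation`, for every
`c ≠ 0` there is `C' > 0` such that for all `M`, all `K ≤ ⌊√M⌋` and all DISTINCT dilations
`n 0, …, n (K−1) ∈ [1, 2M]`:  `Σ_{s<K} |P c (n s) M| ≤ C'·√K·M`.  Proof: the amplifier with the signs
`a s = sgn P c (n s) M`; `M + (K−1)·2Q ≤ 5M`, `K²·C·M^{3/4+ϑ} ≤ C·K·QM`, so `Q·Σ² ≤ 5(1+C)·K·Q·M²`. -/
theorem sum_abs_P_le_of_fanDecorrelation (hFD : FanDecorrelation) {c : ℤ} (hc : c ≠ 0) :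
    ∃ C' : ℝ, 0 < C' ∧ ∀ (M K : ℕ) (n : ℕ → ℕ), K ≤ Nat.sqrt M →
      (∀ s ∈ range K, 1 ≤ n s ∧ n s ≤ 2 * M) →
      (∀ s ∈ range K, ∀ s' ∈ range K, n s = n s' → s = s') →
        ∑ s ∈ range K, |P c (n s) M| ≤ C' * Real.sqrt K * M := by
  obtain ⟨ϑ, hϑ, C, hC0, hamp⟩ := amplifier_of_fanDecorrelation hFD hc
  refine ⟨3 * Real.sqrt (1 + C), by positivity, ?_⟩
  intro M K n hKM hn hinj
  rcases Nat.eq_zero_or_pos K with hK0 | hKpos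
  · subst hK0
    simp
  have hM1 : 1 ≤ M := by
    rcases Nat.eq_zero_or_pos M with hM0 | hM
    · exfalso
      subst hM0
      rw [Nat.sqrt_zero] at hKM
      omega
    · exact hM
  have hMr1 : (1 : ℝ) ≤ M := by exact_mod_cast hM1
  have hMpos : (0 : ℝ) < M := by linarith
  obtain ⟨a, ha⟩ : ∃ a : ℕ → ℝ, a = fun s => if 0 ≤ P c (n s) M then 1 else -1 := ⟨_, rfl⟩
  have ha_abs : ∀ s, |a s| = 1 := by
    intro s; rw [ha]; dsimp only; split_ifs <;> simp
  have ha_sq : ∀ s, a s ^ 2 = 1 := by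
    intro s; rw [ha]; dsimp only; split_ifs <;> simp
  have ha_mul : ∀ s, a s * P c (n s) M = |P c (n s) M| := by
    intro s; rw [ha]; dsimp only
    split_ifs with h
    · rw [one_mul, abs_of_nonneg h]
    · push Not at h
      rw [abs_of_neg h]; ring
  have hSg0 : 0 ≤ ∑ s ∈ range K, |P c (n s) M| := sum_nonneg fun _ _ => abs_nonneg _
  have hW : ∑ s ∈ range K, a s * P c (n s) M = ∑ s ∈ range K, |P c (n s) M| :=
    sum_congr rfl fun s _ => ha_mul s
  have hA2 : ∑ s ∈ range K, a s ^ 2 = K := by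
    rw [sum_congr rfl fun s _ => ha_sq s, sum_const, card_range, nsmul_eq_mul, mul_one]
  have hA1 : ∑ s ∈ range K, |a s| = K := by
    rw [sum_congr rfl fun s _ => ha_abs s, sum_const, card_range, nsmul_eq_mul, mul_one]
  have hmain := hamp M K n a hKpos hn hinj
  rw [hW, hA2, hA1] at hmain
  obtain ⟨Qr, hQr⟩ : ∃ Qr : ℝ, Qr = (Nat.sqrt M : ℝ) + 1 := ⟨_, rfl⟩
  obtain ⟨E, hE⟩ : ∃ E : ℝ, E = (M : ℝ) ^ (3 / 4 + ϑ) := ⟨_, rfl⟩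
  obtain ⟨Sg, hSg⟩ : ∃ Sg : ℝ, Sg = ∑ s ∈ range K, |P c (n s) M| := ⟨_, rfl⟩
  rw [← hQr, ← hE, ← hSg] at hmain
  rw [← hSg] at hSg0 ⊢
  have hQ1 : (1 : ℝ) ≤ Qr := by
    rw [hQr]; linarith [(Nat.cast_nonneg (Nat.sqrt M) : (0:ℝ) ≤ _)]
  have hQpos : 0 < Qr := by linarith
  have hKQ : (K : ℝ) ≤ Qr := by
    have : (K : ℝ) ≤ (Nat.sqrt M : ℝ) := by exact_mod_cast hKM
    rw [hQr]; linarith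
  have hKQM : (K : ℝ) * Qr ≤ 2 * M := by
    have hs : (Nat.sqrt M : ℝ) * (Nat.sqrt M : ℝ) ≤ M := by
      have := Nat.sqrt_le M
      exact_mod_cast this
    have hsM : (Nat.sqrt M : ℝ) ≤ M := by
      have := Nat.sqrt_le_self M
      exact_mod_cast this
    have hKs : (K : ℝ) ≤ (Nat.sqrt M : ℝ) := by exact_mod_cast hKM
    calc (K : ℝ) * Qr ≤ (Nat.sqrt M : ℝ) * Qr := mul_le_mul_of_nonneg_right hKs hQpos.le
      _ = (Nat.sqrt M : ℝ) * (Nat.sqrt M : ℝ) + (Nat.sqrt M : ℝ) := by rw [hQr]; ring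
      _ ≤ M + M := add_le_add hs hsM
      _ = 2 * M := by ring
  have hN : (M : ℝ) + ((K : ℝ) - 1) * (2 * Qr) ≤ 5 * M := by
    have h1 : ((K : ℝ) - 1) * (2 * Qr) = 2 * ((K : ℝ) * Qr) - 2 * Qr := by ring
    rw [h1]
    linarith
  have hEM : E ≤ M := by
    rw [hE]
    calc (M : ℝ) ^ (3 / 4 + ϑ) ≤ (M : ℝ) ^ (1 : ℝ) :=
          Real.rpow_le_rpow_of_exponent_le hMr1 (by linarith)
      _ = M := Real.rpow_one _
  have hE0 : 0 ≤ E := by rw [hE]; exact Real.rpow_nonneg hMpos.le _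
  have hS : (K : ℝ) * (Qr * M) + (K : ℝ) ^ 2 * (C * E) ≤ (1 + C) * ((K : ℝ) * (Qr * M)) := by
    have hK0 : (0 : ℝ) ≤ K := by positivity
    have hCE : C * E ≤ C * M := mul_le_mul_of_nonneg_left hEM hC0
    have hCE0 : 0 ≤ C * E := mul_nonneg hC0 hE0
    have h1 : (K : ℝ) ^ 2 * (C * E) ≤ (K : ℝ) * Qr * (C * M) := by
      calc (K : ℝ) ^ 2 * (C * E) = (K : ℝ) * (K : ℝ) * (C * E) := by ring
        _ ≤ (K : ℝ) * Qr * (C * E) := by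
            apply mul_le_mul_of_nonneg_right _ hCE0
            exact mul_le_mul_of_nonneg_left hKQ hK0
        _ ≤ (K : ℝ) * Qr * (C * M) := by
            apply mul_le_mul_of_nonneg_left hCE
            positivity
    have h2 : (1 + C) * ((K : ℝ) * (Qr * M)) = (K : ℝ) * (Qr * M) + (K : ℝ) * Qr * (C * M) := by ring
    rw [h2]
    linarith
  -- combine: `Qr Sg² ≤ 5M · (1+C) K Qr M`
  have hcomb : Qr * Sg ^ 2 ≤ 5 * (M : ℝ) * ((1 + C) * ((K : ℝ) * (Qr * M))) := by
    have hS0 : 0 ≤ (K : ℝ) * (Qr * M) + (K : ℝ) ^ 2 * (C * E) := by positivity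
    calc Qr * Sg ^ 2 ≤ ((M : ℝ) + ((K : ℝ) - 1) * (2 * Qr)) *
          ((K : ℝ) * (Qr * M) + (K : ℝ) ^ 2 * (C * E)) := hmain
      _ ≤ 5 * (M : ℝ) * ((K : ℝ) * (Qr * M) + (K : ℝ) ^ 2 * (C * E)) :=
          mul_le_mul_of_nonneg_right hN hS0
      _ ≤ 5 * (M : ℝ) * ((1 + C) * ((K : ℝ) * (Qr * M))) :=
          mul_le_mul_of_nonneg_left hS (by positivity)
  -- divide by `Qr`: `Sg² ≤ 5(1+C) K M²`
  have hsq : Sg ^ 2 ≤ 5 * (1 + C) * K * (M : ℝ) ^ 2 := by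
    have h1 : Qr * Sg ^ 2 ≤ Qr * (5 * (1 + C) * K * (M : ℝ) ^ 2) := by
      calc Qr * Sg ^ 2 ≤ 5 * (M : ℝ) * ((1 + C) * ((K : ℝ) * (Qr * M))) := hcomb
        _ = Qr * (5 * (1 + C) * K * (M : ℝ) ^ 2) := by ring
    exact le_of_mul_le_mul_left h1 hQpos
  have hR : (3 * Real.sqrt (1 + C) * Real.sqrt K * M) ^ 2 = 9 * (1 + C) * K * (M : ℝ) ^ 2 := by
    have h1 : Real.sqrt (1 + C) ^ 2 = 1 + C := Real.sq_sqrt (by linarith)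
    have h2 : Real.sqrt (K : ℝ) ^ 2 = K := Real.sq_sqrt (by positivity)
    calc (3 * Real.sqrt (1 + C) * Real.sqrt K * M) ^ 2
        = 9 * Real.sqrt (1 + C) ^ 2 * Real.sqrt (K : ℝ) ^ 2 * (M : ℝ) ^ 2 := by ring
      _ = 9 * (1 + C) * K * (M : ℝ) ^ 2 := by rw [h1, h2]
  have hR0 : 0 ≤ 3 * Real.sqrt (1 + C) * Real.sqrt K * M := by positivity
  have hle : Sg ^ 2 ≤ (3 * Real.sqrt (1 + C) * Real.sqrt K * M) ^ 2 := by
    rw [hR]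
    have : 0 ≤ (1 + C) * K * (M : ℝ) ^ 2 := by positivity
    linarith
  calc Sg = Real.sqrt (Sg ^ 2) := (Real.sqrt_sq hSg0).symm
    _ ≤ Real.sqrt ((3 * Real.sqrt (1 + C) * Real.sqrt K * M) ^ 2) := Real.sqrt_le_sqrt hle
    _ = 3 * Real.sqrt (1 + C) * Real.sqrt K * M := Real.sqrt_sq hR0

/-- **Square-root saving in the number of dilations (set form).**  Under `FanDecorrelation`, for every
`c ≠ 0` there is `C' > 0` such that for every scale `M` and every set `S ⊂ [1, 2M]` of at most `⌊√M⌋`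
dilations, `Σ_{n∈S} |Σ_{m∈(M,2M]} λ(mn+c)| ≤ C'·√#S·M`.  For `#S = ⌊√M⌋` moduli `n ∈ (M,2M]` (modulus
`≍ √height`, where GRH is trivial) the absolute one-point sums must AVERAGE `≤ C'·M^{3/4}`. -/
theorem dilationSet_sum_abs_P_le (hFD : FanDecorrelation) {c : ℤ} (hc : c ≠ 0) :
    ∃ C' : ℝ, 0 < C' ∧ ∀ (M : ℕ) (S : Finset ℕ), S.card ≤ Nat.sqrt M →
      (∀ n ∈ S, 1 ≤ n ∧ n ≤ 2 * M) →
        ∑ n ∈ S, |P c n M| ≤ C' * Real.sqrt S.card * M := by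
  obtain ⟨C', hC', hlaw⟩ := sum_abs_P_le_of_fanDecorrelation hFD hc
  refine ⟨C', hC', ?_⟩
  intro M S hS hmem
  -- enumerate `S`
  obtain ⟨e⟩ : Nonempty (S ≃ Fin S.card) := ⟨S.equivFin⟩
  obtain ⟨n, hn⟩ : ∃ n : ℕ → ℕ, n = fun s => if h : s < S.card then ((e.symm ⟨s, h⟩ : S) : ℕ) else 0 :=
    ⟨_, rfl⟩
  have hn_fin : ∀ i : Fin S.card, n i = ((e.symm i : S) : ℕ) := by
    intro i
    rw [hn]
    dsimp only
    rw [dif_pos i.2]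
  have hn_mem : ∀ s ∈ range S.card, n s ∈ S := by
    intro s hs
    rw [mem_range] at hs
    have h := hn_fin ⟨s, hs⟩
    dsimp only at h
    rw [h]
    exact (e.symm ⟨s, hs⟩).2
  have hinj : ∀ s ∈ range S.card, ∀ s' ∈ range S.card, n s = n s' → s = s' := by
    intro s hs s' hs' heq
    rw [mem_range] at hs hs'
    have h1 := hn_fin ⟨s, hs⟩
    have h2 := hn_fin ⟨s', hs'⟩
    dsimp only at h1 h2
    rw [h1, h2] at heq
    have h3 : (e.symm ⟨s, hs⟩ : S) = e.symm ⟨s', hs'⟩ := Subtype.ext heq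
    have h4 := e.symm.injective h3
    simpa using h4
  have hsum : ∑ s ∈ range S.card, |P c (n s) M| = ∑ x ∈ S, |P c x M| := by
    rw [sum_range]
    have h1 : ∑ i : Fin S.card, |P c (n (i : ℕ)) M| = ∑ i : Fin S.card, |P c ((e.symm i : S) : ℕ) M| :=
      Fintype.sum_congr _ _ fun i => by rw [hn_fin i]
    have h2 : ∑ i : Fin S.card, |P c ((e.symm i : S) : ℕ) M| = ∑ x : S, |P c (x : ℕ) M| :=
      Fintype.sum_equiv e.symm _ _ (fun i => rfl)
    rw [h1, h2]
    exact sum_coe_sort S (fun x => |P c x M|)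
  have h := hlaw M S.card n hS (fun s hs => hmem _ (hn_mem s hs)) hinj
  rw [hsum] at h
  exact h

/-! ## §2 The first absolute moment over all moduli `n ∈ (M, 2M]` -/

/-- Block counting: if every sub-family of at most `q` members of `A` has `f`-sum at most `B`, and
`#A ≤ k·q`, then the `f`-sum over `A` is at most `k·B` (peel off `q` members at a time). [folklore] -/
theorem sum_le_mul_of_small_subsets (f : ℕ → ℝ) (q : ℕ) (B : ℝ) :
    ∀ (k : ℕ) (A : Finset ℕ), A.card ≤ k * q →
      (∀ S ⊆ A, S.card ≤ q → ∑ n ∈ S, f n ≤ B) → ∑ n ∈ A, f n ≤ k * B := by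
  intro k
  induction k with
  | zero =>
      intro A hA _
      have hA0 : A = ∅ := Finset.card_eq_zero.mp (by omega)
      subst hA0
      simp
  | succ k ih =>
      intro A hA hS
      have hB0 : 0 ≤ B := by
        have := hS ∅ (Finset.empty_subset _) (by simp)
        simpa using this
      by_cases hsmall : A.card ≤ q
      · have h1 := hS A (Finset.Subset.refl _) hsmall
        have hk : (0 : ℝ) ≤ k := Nat.cast_nonneg _
        push_cast
        nlinarith
      · push Not at hsmall
        obtain ⟨S, hSA, hScard⟩ := Finset.exists_subset_card_eq (show q ≤ A.card by omega)
        have hsplit : ∑ n ∈ A, f n = ∑ n ∈ S, f n + ∑ n ∈ A \ S, f n := by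
          rw [← Finset.sum_union (Finset.disjoint_sdiff), Finset.union_sdiff_of_subset hSA]
        have hrest : ∑ n ∈ A \ S, f n ≤ k * B := by
          refine ih (A \ S) ?_ ?_
          · rw [Finset.card_sdiff_of_subset hSA, hScard]
            have : A.card ≤ (k + 1) * q := hA
            rw [Nat.succ_mul] at this
            omega
          · intro S' hS' hcard'
            exact hS S' (fun x hx => (Finset.mem_sdiff.mp (hS' hx)).1) hcard'
        have hfirst : ∑ n ∈ S, f n ≤ B := hS S hSA hScard.le
        rw [hsplit]
        push_cast
        linarith

/-- **First absolute moment at moduli `≍ √height` (fixed residue).**  Under `FanDecorrelation`, for every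
`c ≠ 0` there is `C` with `Σ_{n∈(M,2M]} |Σ_{m∈(M,2M]} λ(mn+c)| ≤ C·M^{7/4}` for all `M` (`M`-term progressions
`c mod n`, modulus `n ≍ M ≍ √(4M²)` = level `1/2` of the height; trivial `M²`, random `M^{3/2}`).  Proof: chop
`(M,2M]` into `≤ ⌊√M⌋ + 4` families of `≤ ⌊√M⌋` moduli and apply `dilationSet_sum_abs_P_le` to each. -/
theorem firstMoment_abs_P_le_of_fanDecorrelation (hFD : FanDecorrelation) {c : ℤ} (hc : c ≠ 0) :
    ∃ C : ℝ, 0 < C ∧ ∀ M : ℕ,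
      ∑ n ∈ Ioc M (2 * M), |P c n M| ≤ C * (M : ℝ) ^ (7 / 4 : ℝ) := by
  obtain ⟨C', hC', hlaw⟩ := dilationSet_sum_abs_P_le hFD hc
  refine ⟨5 * C', by positivity, ?_⟩
  intro M
  rcases Nat.eq_zero_or_pos M with hM0 | hMpos
  · subst hM0
    simp
  -- the block size `q = ⌊√M⌋ ≥ 1` and the block count `q + 4`
  set q : ℕ := Nat.sqrt M with hq
  have hq1 : 1 ≤ q := by rw [hq]; exact Nat.sqrt_pos.mpr hMpos
  have hMqq : M ≤ (q + 4) * q := by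
    have h1 : M < (q + 1) * (q + 1) := by rw [hq]; exact Nat.lt_succ_sqrt M
    nlinarith
  have hMr : (0 : ℝ) < M := by exact_mod_cast hMpos
  have hqr1 : (1 : ℝ) ≤ q := by exact_mod_cast hq1
  -- every family of `≤ q` moduli in `(M,2M]` has sum `≤ C' √q M`
  have hblocks : ∀ S ⊆ Ioc M (2 * M), S.card ≤ q → ∑ n ∈ S, |P c n M| ≤ C' * Real.sqrt q * M := by
    intro S hS hcard
    have hmem : ∀ n ∈ S, 1 ≤ n ∧ n ≤ 2 * M := by
      intro n hn
      have := Finset.mem_Ioc.mp (hS hn)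
      omega
    have h := hlaw M S hcard hmem
    have hsc : Real.sqrt (S.card : ℝ) ≤ Real.sqrt q := Real.sqrt_le_sqrt (by exact_mod_cast hcard)
    calc ∑ n ∈ S, |P c n M| ≤ C' * Real.sqrt S.card * M := h
      _ ≤ C' * Real.sqrt q * M := by
          apply mul_le_mul_of_nonneg_right _ hMr.le
          exact mul_le_mul_of_nonneg_left hsc hC'.le
  have hcardA : (Ioc M (2 * M)).card ≤ (q + 4) * q := by
    rw [Nat.card_Ioc]; omega
  have hsum := sum_le_mul_of_small_subsets (fun n => |P c n M|) q (C' * Real.sqrt q * M) (q + 4)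
    (Ioc M (2 * M)) hcardA hblocks
  -- `(q+4) · C' √q M ≤ 5 q · C' √q M ≤ 5 C' M^{3/4} M = 5 C' M^{7/4}`
  have hq4 : ((q + 4 : ℕ) : ℝ) ≤ 5 * q := by push_cast; linarith
  have hsq0 : 0 ≤ Real.sqrt (q : ℝ) := Real.sqrt_nonneg _
  have hqle : (q : ℝ) ≤ (M : ℝ) ^ (1 / 2 : ℝ) := by
    have hqq : ((q : ℝ)) ^ 2 ≤ M := by
      have := Nat.sqrt_le' M
      rw [hq]; exact_mod_cast this
    have hq0 : (0 : ℝ) ≤ q := Nat.cast_nonneg _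
    calc (q : ℝ) = Real.sqrt ((q : ℝ) ^ 2) := (Real.sqrt_sq hq0).symm
      _ ≤ Real.sqrt M := Real.sqrt_le_sqrt hqq
      _ = (M : ℝ) ^ (1 / 2 : ℝ) := Real.sqrt_eq_rpow _
  have hsqle : Real.sqrt (q : ℝ) ≤ (M : ℝ) ^ (1 / 4 : ℝ) := by
    have hq0 : (0 : ℝ) ≤ q := Nat.cast_nonneg _
    calc Real.sqrt (q : ℝ) ≤ Real.sqrt ((M : ℝ) ^ (1 / 2 : ℝ)) := Real.sqrt_le_sqrt hqle
      _ = ((M : ℝ) ^ (1 / 2 : ℝ)) ^ (1 / 2 : ℝ) := Real.sqrt_eq_rpow _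
      _ = (M : ℝ) ^ (1 / 4 : ℝ) := by
          rw [← Real.rpow_mul hMr.le]; norm_num
  have hpow : (q : ℝ) * Real.sqrt q * M ≤ (M : ℝ) ^ (7 / 4 : ℝ) := by
    have h34 : (q : ℝ) * Real.sqrt q ≤ (M : ℝ) ^ (1 / 2 : ℝ) * (M : ℝ) ^ (1 / 4 : ℝ) :=
      mul_le_mul hqle hsqle hsq0 (Real.rpow_nonneg hMr.le _)
    have h74 : (M : ℝ) ^ (1 / 2 : ℝ) * (M : ℝ) ^ (1 / 4 : ℝ) * M = (M : ℝ) ^ (7 / 4 : ℝ) := by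
      rw [← Real.rpow_add hMr]
      conv_lhs => rw [show (M : ℝ) = (M : ℝ) ^ (1 : ℝ) from (Real.rpow_one _).symm]
      rw [← Real.rpow_mul hMr.le, ← Real.rpow_add hMr]
      norm_num
    calc (q : ℝ) * Real.sqrt q * M ≤ (M : ℝ) ^ (1 / 2 : ℝ) * (M : ℝ) ^ (1 / 4 : ℝ) * M :=
          mul_le_mul_of_nonneg_right h34 hMr.le
      _ = (M : ℝ) ^ (7 / 4 : ℝ) := h74
  calc ∑ n ∈ Ioc M (2 * M), |P c n M| ≤ ((q + 4 : ℕ) : ℝ) * (C' * Real.sqrt q * M) := hsum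
    _ ≤ (5 * q) * (C' * Real.sqrt q * M) := by
        apply mul_le_mul_of_nonneg_right hq4
        positivity
    _ = 5 * C' * ((q : ℝ) * Real.sqrt q * M) := by ring
    _ ≤ 5 * C' * (M : ℝ) ^ (7 / 4 : ℝ) := by
        apply mul_le_mul_of_nonneg_left hpow
        positivity

/-- `firstMoment_abs_P_le_of_fanDecorrelation` in the crux's own spelling (`P`, `L` unfolded):
`Σ_{n∈(M,2M]} |Σ_{m∈(M,2M]} λ(mn+c)| ≤ C·M^{7/4}`. -/
theorem firstMoment_liouville_of_fanDecorrelation (hFD : FanDecorrelation) {c : ℤ} (hc : c ≠ 0) :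
    ∃ C : ℝ, 0 < C ∧ ∀ M : ℕ, ∑ n ∈ Ioc M (2 * M),
      |∑ m ∈ Ioc M (2 * M), (ArithmeticFunction.liouville (Int.toNat ((m : ℤ) * n + c)) : ℝ)| ≤
        C * (M : ℝ) ^ (7 / 4 : ℝ) :=
  firstMoment_abs_P_le_of_fanDecorrelation hFD hc

/-! ## §3 Few biased dilations -/

/-- **Few biased dilations.**  Under `FanDecorrelation`, for every `c ≠ 0` there is `C'` such that for
every `M`, every `b > 0` and every set `S ⊂ [1,2M]` of at most `⌊√M⌋` dilations each carrying a bias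
`|P c n M| ≥ b·M`: `b²·#S ≤ C'²`.  (No sign coherence among the biases is asked; compare `CoherentBias`
in the Siegel mirrors, excluded there only for `b²·V ≥ 4`.) -/
theorem card_biased_dilations_le (hFD : FanDecorrelation) {c : ℤ} (hc : c ≠ 0) :
    ∃ C' : ℝ, 0 < C' ∧ ∀ (M : ℕ) (S : Finset ℕ) (b : ℝ), 0 < b → S.card ≤ Nat.sqrt M →
      (∀ n ∈ S, 1 ≤ n ∧ n ≤ 2 * M) → (∀ n ∈ S, b * M ≤ |P c n M|) →
        b ^ 2 * S.card ≤ C' ^ 2 := by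
  obtain ⟨C', hC', hlaw⟩ := dilationSet_sum_abs_P_le hFD hc
  refine ⟨C', hC', ?_⟩
  intro M S b hb hS hmem hbias
  rcases Nat.eq_zero_or_pos S.card with h0 | hpos
  · rw [h0]
    simp only [Nat.cast_zero, mul_zero]
    positivity
  have hM1 : 1 ≤ M := by
    rcases Nat.eq_zero_or_pos M with hM0 | hM
    · exfalso
      subst hM0
      rw [Nat.sqrt_zero] at hS
      omega
    · exact hM
  have hMpos : (0 : ℝ) < M := by exact_mod_cast hM1
  have hcard : (0 : ℝ) < S.card := by exact_mod_cast hpos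
  have h := hlaw M S hS hmem
  -- `b M #S ≤ Σ ≤ C' √#S M`
  have hlow : b * M * S.card ≤ ∑ n ∈ S, |P c n M| := by
    calc b * M * S.card = ∑ _n ∈ S, b * M := by rw [sum_const, nsmul_eq_mul]; ring
      _ ≤ ∑ n ∈ S, |P c n M| := sum_le_sum fun n hn => hbias n hn
  have h1 : b * S.card ≤ C' * Real.sqrt S.card := by
    have h2 : b * M * S.card ≤ C' * Real.sqrt S.card * M := le_trans hlow h
    have h3 : M * (b * S.card) ≤ M * (C' * Real.sqrt S.card) := by linarith
    exact le_of_mul_le_mul_left h3 hMpos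
  have hsq : Real.sqrt (S.card : ℝ) ^ 2 = S.card := Real.sq_sqrt hcard.le
  have h4 : (b * S.card) ^ 2 ≤ (C' * Real.sqrt S.card) ^ 2 :=
    pow_le_pow_left₀ (by positivity) h1 2
  have h5 : b ^ 2 * (S.card : ℝ) ^ 2 ≤ C' ^ 2 * S.card := by
    calc b ^ 2 * (S.card : ℝ) ^ 2 = (b * S.card) ^ 2 := by ring
      _ ≤ (C' * Real.sqrt S.card) ^ 2 := h4
      _ = C' ^ 2 * S.card := by rw [mul_pow, hsq]
  have h6 : (S.card : ℝ) * (b ^ 2 * S.card) ≤ (S.card : ℝ) * C' ^ 2 := by linarith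
  exact le_of_mul_le_mul_left h6 hcard

/-- `_false_of_` form (hardness certificate): if at some shift `c ≠ 0` there are, for every `A`, a scale
`M`, a bias `b > 0` and a set of at most `⌊√M⌋` dilations in `[1,2M]`, each with `|P c n M| ≥ b·M`, of
total weight `b²·#S > A`, then `FanDecorrelation` fails.  (Believed false; no such family is known.) -/
theorem FanDecorrelation_false_of_biasedDilations {c : ℤ} (hc : c ≠ 0)
    (h : ∀ A : ℝ, ∃ (M : ℕ) (S : Finset ℕ) (b : ℝ), 0 < b ∧ S.card ≤ Nat.sqrt M ∧
      (∀ n ∈ S, 1 ≤ n ∧ n ≤ 2 * M) ∧ (∀ n ∈ S, b * M ≤ |P c n M|) ∧ A < b ^ 2 * S.card) :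
    ¬ FanDecorrelation := by
  intro hFD
  obtain ⟨C', -, hle⟩ := card_biased_dilations_le hFD hc
  obtain ⟨M, S, b, hb, hS, hmem, hbias, hA⟩ := h (C' ^ 2)
  have := hle M S b hb hS hmem hbias
  linarith

end Summit.Parity.GeneralizedHardyLittlewood.Theorems.FanDecorrelation.Negative.DilationAmplifier

end
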